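import Mathlib
import Summits.ValiantsHypothesis.ValiantsHypothesis.Theorems.NewtonUnitEquationsDissociatedUniformTotalsLawConvexPosition
import Summits.ValiantsHypothesis.ValiantsHypothesis.Theorems.NewtonUnitEquationsDissociatedUniformTotalsLawCert
import HarnessLib

/-!
# Crux `NewtonUnitEquations.DissociatedUniform` (stmt-ValiantsHypothesis-5905): on the SMOOTH stratum the totals law has NO
# POINTWISE companion — a kernel witness with one class of `57 > 5q` hull vertices at `q = 11`

The smooth stratum of the `n = 3` totals law (all three hodographs convexly ordered; `…TotalsLawHodographFamilies`:
`T ≤ 6q² + 6Z`, census `T ≤ 2q²`) was conjectured sharp in the TOTALS (`SmoothSharpTotalsLaw`, `…TotalsLawHexTop`), and the census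
of NOTES-t1g7 §3 reported `max_s V_s = 2q + O(1)`.  For PAIRS the tree even has a uniform pointwise theorem
(`…TotalsLawLeftTurning.unionVert_le_twelve_mul`: `≤ 12q` vertices for every union of fibres of a co-oriented convex pair).
This file shows by an explicit integer configuration that for TRIPLES no such pointwise statement survives on the smooth stratum:

* `A11`, `B11` — two near-regular hendecagons (counter-clockwise; `B11` = `0.85 ×` a slightly rotated copy, so that every pair fibre
  `P_r = {a x + b (r − x)}` is an elongated sampled ellipse whose hull-edge normals cluster at a direction rotating by `π/11` with `r`),
  `C11` — a large CLOCKWISE "fan" hendecagon whose normal cones are matched to those cluster directions for the class `s = 0`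
  (memo `Cruxes/DissociatedUniform/NOTES-t1g8.md` §2: the regime formula `V_s = q + Σ_z #(normals of P_{s−z} in the cone K_z)` locks when the
  third curve is CONTRA-oriented, giving `V_{s₀} ≈ q²/2` along the family, while co-oriented cones drift against the clusters);
* all three curves AND their hodographs are in strict convex position in the listed order (`decide` on the integer cross
  products via `…TotalsLawConvexPosition`), hence convexly ordered and smooth, `A11`, `B11` left-turning, `C11` right-turning, all
  injective;
* `le_classVert_witness : 57 ≤ V_0` by 57 brute-force strict-top certificates (`Cert₃`: an integer weight scoring the certified word
  strictly above every other class point; checked by `decide`), the certified points being exactly the forward simplex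
  `{m + (i, j, k) : i + j + k = ŝ}` swept by the class (`…TotalsLawTripleChains`);
* **`exists_smooth_fat_class`** and **`not_smooth_classBound_five`**: there is NO bound `V_s ≤ 5q` on the smooth stratum
  (the census family gives `V_s/q² → 1/2`; this file is its first kernel member).  The totals of the witness are `T = 242 = 2q²`
  exactly (census, not certified here), consistent with `SmoothSharpTotalsLaw`.
Honest label: a located NEGATIVE fact about the shape of the law (pointwise fails, totals must be amortised); `TotalsLawThree`,
`SmoothSharpTotalsLaw` remain OPEN; nothing here bears on VP ≠ VNP.
[folklore: exposed points are extreme]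
-/

set_option linter.dupNamespace false -- `ValiantsHypothesis.ValiantsHypothesis` (summit = problem) in every name

open scoped BigOperators

namespace Summit.ValiantsHypothesis.ValiantsHypothesis.Theorems.NewtonUnitEquationsDissociatedUniform

namespace TotalsLaw

open Literature.Computability.AlgebraicComplexity.KPTT.PlanarMinkowski TotalsLawN.Cert

section SmoothPointwise

variable {q : ℕ} [NeZero q]

/-! ### Brute-force strict-top certificates for three integer curves -/

/-- The integer class point of the pair `(x, y)` in class `s` (third letter `s − x − y`). -/
def ipt₃ (A B C : ZMod q → ℤ × ℤ) (s : ZMod q) (xy : ZMod q × ZMod q) : ℤ × ℤ :=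
  ((A xy.1).1 + (B xy.2).1 + (C (s - xy.1 - xy.2)).1, (A xy.1).2 + (B xy.2).2 + (C (s - xy.1 - xy.2)).2)

/-- Integer score `⟨w, p⟩`. -/
def iscore (w p : ℤ × ℤ) : ℤ := w.1 * p.1 + w.2 * p.2

/-- A brute-force certificate `(word, weight)`: the weight scores the word's class point strictly above every other class point
(reducible, so that `decide` evaluates it). -/
abbrev Cert₃ (A B C : ZMod q → ℤ × ℤ) (s : ZMod q) (rc : (ZMod q × ZMod q) × (ℤ × ℤ)) : Prop :=
  ∀ xy : ZMod q × ZMod q,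
    ipt₃ A B C s xy = ipt₃ A B C s rc.1 ∨ iscore rc.2 (ipt₃ A B C s xy) < iscore rc.2 (ipt₃ A B C s rc.1)

omit [NeZero q] in
/-- The cast class point is the class point of the real curves. [folklore] -/
theorem castPt_ipt₃ (A B C : ZMod q → ℤ × ℤ) (s : ZMod q) (xy : ZMod q × ZMod q) :
    castPt (ipt₃ A B C s xy) = intCurve A xy.1 + intCurve B xy.2 + intCurve C (s - xy.1 - xy.2) := by
  ext t; fin_cases t <;> simp [castPt, ipt₃, intCurve]

/-- The real pairing of the cast weight with a cast point is the cast integer score. [folklore] -/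
theorem dotProduct_castPt (w p : ℤ × ℤ) : ![(w.1 : ℝ), (w.2 : ℝ)] ⬝ᵥ castPt p = (iscore w p : ℝ) := by
  simp [castPt, dotProduct, Fin.sum_univ_two, iscore]

/-- **A certificate gives a strict top** of the Finset model of the class. [folklore] -/
theorem isStrictTop_of_cert₃ {A B C : ZMod q → ℤ × ℤ} {s : ZMod q} {rc : (ZMod q × ZMod q) × (ℤ × ℤ)}
    (h : Cert₃ A B C s rc) :
    IsStrictTop ![(rc.2.1 : ℝ), (rc.2.2 : ℝ)] (classFin (intCurve A) (intCurve B) (intCurve C) s)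
      (castPt (ipt₃ A B C s rc.1)) := by
  classical
  refine ⟨?_, fun y hy hne => ?_⟩
  · rw [castPt_ipt₃]
    exact mem_classFin_of_sum_eq (by ring)
  · obtain ⟨xy, -, rfl⟩ := Finset.mem_image.1 hy
    have hrepr : intCurve A xy.1 + intCurve B xy.2 + intCurve C (s - xy.1 - xy.2) = castPt (ipt₃ A B C s xy) :=
      (castPt_ipt₃ A B C s xy).symm
    rw [hrepr] at hne ⊢
    rcases h xy with heq | hlt
    · exact absurd (congrArg castPt heq) hne
    · rw [dotProduct_castPt, dotProduct_castPt]
      exact_mod_cast hlt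

/-- **A certificate gives a hull vertex** of the class. [folklore] -/
theorem mem_extremePoints_of_cert₃ {A B C : ZMod q → ℤ × ℤ} {s : ZMod q} {rc : (ZMod q × ZMod q) × (ℤ × ℤ)}
    (h : Cert₃ A B C s rc) :
    castPt (ipt₃ A B C s rc.1) ∈ (convexHull ℝ (classPts (intCurve A) (intCurve B) (intCurve C) s)).extremePoints ℝ := by
  rw [← coe_classFin]
  exact (isStrictTop_of_cert₃ h).mem_extremePoints

/-- **Counting.**  Certificates with pairwise distinct class points bound `V_s` from below by their number. [folklore] -/
theorem length_le_classVert₃ (A B C : ZMod q → ℤ × ℤ) (s : ZMod q) (recs : List ((ZMod q × ZMod q) × (ℤ × ℤ)))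
    (hok : ∀ rc ∈ recs, Cert₃ A B C s rc) (hnd : (recs.map fun rc => ipt₃ A B C s rc.1).Nodup) :
    recs.length ≤ classVert (intCurve A) (intCurve B) (intCurve C) s := by
  classical
  set V := ((recs.map fun rc => ipt₃ A B C s rc.1).toFinset).image castPt with hV
  have hcard : V.card = recs.length := by
    rw [hV, Finset.card_image_of_injective _ castPt_injective, List.toFinset_card_of_nodup hnd, List.length_map]
  rw [← hcard]
  unfold classVert
  rw [← Set.ncard_coe_finset]
  refine Set.ncard_le_ncard (fun p hp => ?_) ((Set.finite_range _).subset extremePoints_convexHull_subset)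
  obtain ⟨p', hp', rfl⟩ := Finset.mem_image.1 (Finset.mem_coe.1 hp)
  obtain ⟨rc, hrc, rfl⟩ := List.mem_map.1 (List.mem_toFinset.1 hp')
  exact mem_extremePoints_of_cert₃ (hok rc hrc)

omit [NeZero q] in
/-- The real curve of an injective integer curve is injective. [folklore] -/
theorem injective_intCurve {P : ZMod q → ℤ × ℤ} (h : Function.Injective P) : Function.Injective (intCurve P) := by
  intro x y hxy
  have : castPt (P x) = castPt (P y) := hxy
  exact h (castPt_injective this)

/-! ### The witness at `q = 11` -/

/-- Table lookup `ℤ/q → ℤ²` from a list (entries beyond the list are `(0,0)`). -/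
def tbl (L : List (ℤ × ℤ)) (z : ZMod q) : ℤ × ℤ := L.getD z.val (0, 0)

/-- `A11`: a near-regular hendecagon of circumradius `500`, counter-clockwise. -/
def A11 : ZMod 11 → ℤ × ℤ := tbl [(500, 0), (421, 270), (208, 455), (-71, 495), (-327, 378), (-480, 141), (-480, -141), (-327, -378), (-71, -495), (208, -455), (421, -270)]

/-- `B11`: `0.85 ×` a copy of `A11` rotated by `0.3/11`, counter-clockwise. -/
def B11 : ZMod 11 → ℤ × ℤ := tbl [(425, 12), (351, 239), (166, 391), (-72, 419), (-287, 313), (-411, 109), (-404, -131), (-269, -329), (-49, -422), (187, -382), (364, -220)]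

/-- `C11`: a large CLOCKWISE fan polygon whose normal cones are matched to the fibre clusters of the class `0`. -/
def C11 : ZMod 11 → ℤ × ℤ := tbl [(-6794, 9490), (-3819, 9104), (-1074, 7895), (1220, 5961), (2876, 3460), (3761, 593), (3802, -2407), (2996, -5296), (1408, -7842), (-832, -9837), (-3544, -11121)]

/-- The 57 certificates `((x, y), (w₁, w₂))` of the class `0`: the words `(x, y, −x−y)` sweep the forward simplex. -/
def recs11 : List ((ZMod 11 × ZMod 11) × (ℤ × ℤ)) := [((6, 5), (-20893, -3250)), ((6, 6), (-20848, -3403)), ((7, 5), (45, -263)), ((8, 4), (233, -874)), ((9, 3), (101, -315)), ((10, 2), (5, -13)),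
  ((0, 1), (327, -697)), ((7, 6), (659, -1379)), ((8, 5), (367, -652)), ((9, 4), (535, -831)), ((10, 3), (533, -745)), ((0, 2), (305, -354)),
  ((8, 6), (1258, -1371)), ((9, 5), (223, -203)), ((10, 4), (765, -631)), ((0, 3), (206, -151)), ((1, 2), (1303, -820)), ((8, 7), (1299, -805)),
  ((9, 6), (663, -350)), ((10, 5), (899, -409)), ((0, 4), (850, -339)), ((1, 3), (64, -19)), ((9, 7), (1799, -474)), ((10, 6), (893, -150)),
  ((0, 5), (328, -39)), ((1, 4), (765, -47)), ((2, 3), (385, 4)), ((9, 8), (1527, 25)), ((10, 7), (746, 63)), ((0, 6), (489, 71)),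
  ((1, 5), (899, 175)), ((2, 4), (1796, 523)), ((10, 8), (354, 115)), ((0, 7), (831, 355)), ((1, 6), (893, 434)), ((2, 5), (223, 125)),
  ((3, 4), (257, 169)), ((10, 9), (1271, 847)), ((0, 8), (593, 456)), ((1, 7), (746, 647)), ((2, 6), (663, 634)), ((3, 5), (1228, 1411)),
  ((0, 9), (589, 720)), ((1, 8), (127, 187)), ((2, 7), (516, 847)), ((3, 6), (361, 677)), ((4, 5), (625, 1406)), ((0, 10), (610, 1399)),
  ((1, 9), (253, 705)), ((2, 8), (139, 474)), ((3, 7), (107, 445)), ((4, 6), (27, 185)), ((1, 10), (212, 1849)), ((2, 9), (23, 905)),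
  ((3, 8), (-24, 991)), ((4, 7), (-63, 764)), ((5, 6), (-81, 295))]

set_option maxRecDepth 200000 in -- `decide` over 57 certificates × 121 class points
/-- All 57 certificates check, and the certified class points are pairwise distinct (`decide`). [folklore] -/
theorem recs11_ok :
    (∀ rc ∈ recs11, Cert₃ A11 B11 C11 0 rc) ∧ (recs11.map fun rc => ipt₃ A11 B11 C11 0 rc.1).Nodup := by
  constructor <;> decide

/-- **`V_0 ≥ 57`** for the witness. [folklore] -/
theorem le_classVert_witness : 57 ≤ classVert (intCurve A11) (intCurve B11) (intCurve C11) 0 := by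
  have h := length_le_classVert₃ A11 B11 C11 0 recs11 recs11_ok.1 recs11_ok.2
  exact le_trans (by decide) h

/-- `A11` is in strict convex position, counter-clockwise (`decide`). [folklore] -/
theorem strictlyConvexCcw_A11 : StrictlyConvexCcw (intCurve A11) := strictlyConvexCcw_intCurve (by decide)

/-- `B11` is in strict convex position, counter-clockwise (`decide`). [folklore] -/
theorem strictlyConvexCcw_B11 : StrictlyConvexCcw (intCurve B11) := strictlyConvexCcw_intCurve (by decide)

/-- `C11` is in strict convex position, CLOCKWISE (`decide`). [folklore] -/
theorem strictlyConvexCw_C11 : StrictlyConvexCw (intCurve C11) := strictlyConvexCw_intCurve (by decide)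

/-- The hodograph of `A11` is in strict convex position (`decide`). [folklore] -/
theorem strictlyConvexCcw_edgeVec_A11 : StrictlyConvexCcw (edgeVec (intCurve A11)) := by
  rw [edgeVec_intCurve]; exact strictlyConvexCcw_intCurve (by decide)

/-- The hodograph of `B11` is in strict convex position (`decide`). [folklore] -/
theorem strictlyConvexCcw_edgeVec_B11 : StrictlyConvexCcw (edgeVec (intCurve B11)) := by
  rw [edgeVec_intCurve]; exact strictlyConvexCcw_intCurve (by decide)

/-- The hodograph of `C11` is in strict convex position (clockwise; `decide`). [folklore] -/
theorem strictlyConvexCw_edgeVec_C11 : StrictlyConvexCw (edgeVec (intCurve C11)) := by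
  rw [edgeVec_intCurve]; exact strictlyConvexCw_intCurve (by decide)

/-- The three curves are injective (`decide`). [folklore] -/
theorem injective_witness :
    Function.Injective (intCurve A11) ∧ Function.Injective (intCurve B11) ∧ Function.Injective (intCurve C11) := by
  refine ⟨injective_intCurve ?_, injective_intCurve ?_, injective_intCurve ?_⟩ <;>
    exact fun x y h => by revert x y; decide

/-- **A smooth configuration with a fat class.**  At `q = 11` there are three injective curves, all convexly ordered with
convexly ordered hodographs (the smooth stratum), the first two left-turning and the third right-turning, with a class of at least
`57 > 5·11` hull vertices. [folklore] -/
theorem exists_smooth_fat_class :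
    ∃ a b c : ZMod 11 → (Fin 2 → ℝ), Function.Injective a ∧ Function.Injective b ∧ Function.Injective c ∧
      ConvexlyOrdered a ∧ ConvexlyOrdered b ∧ ConvexlyOrdered c ∧
      ConvexlyOrdered (edgeVec a) ∧ ConvexlyOrdered (edgeVec b) ∧ ConvexlyOrdered (edgeVec c) ∧
      LeftTurning a ∧ LeftTurning b ∧ RightTurning c ∧ 57 ≤ classVert a b c 0 := by
  have hq : 3 ≤ 11 := by norm_num
  obtain ⟨hA, hB, hC⟩ := injective_witness
  exact ⟨intCurve A11, intCurve B11, intCurve C11, hA, hB, hC,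
    convexlyOrdered_of_strictlyConvexCcw strictlyConvexCcw_A11 hq,
    convexlyOrdered_of_strictlyConvexCcw strictlyConvexCcw_B11 hq,
    convexlyOrdered_of_strictlyConvexCw strictlyConvexCw_C11 hq,
    convexlyOrdered_of_strictlyConvexCcw strictlyConvexCcw_edgeVec_A11 hq,
    convexlyOrdered_of_strictlyConvexCcw strictlyConvexCcw_edgeVec_B11 hq,
    convexlyOrdered_of_strictlyConvexCw strictlyConvexCw_edgeVec_C11 hq,
    leftTurning_of_strictlyConvexCcw strictlyConvexCcw_A11 hq,
    leftTurning_of_strictlyConvexCcw strictlyConvexCcw_B11 hq,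
    rightTurning_of_strictlyConvexCw strictlyConvexCw_C11 hq, le_classVert_witness⟩

/-- **No pointwise bound `V_s ≤ 5q` on the smooth stratum.**  (The census family of NOTES-t1g8 §2 has `V_s / q² → 1/2`; the
totals there are exactly `2q²`.) [folklore] -/
theorem not_smooth_classBound_five :
    ¬ ∀ (q : ℕ) [NeZero q] (a b c : ZMod q → (Fin 2 → ℝ)), ConvexlyOrdered (edgeVec a) → ConvexlyOrdered (edgeVec b) →
      ConvexlyOrdered (edgeVec c) → ∀ s, classVert a b c s ≤ 5 * q := by
  intro h
  obtain ⟨a, b, c, -, -, -, -, -, -, ha, hb, hc, -, -, -, hV⟩ := exists_smooth_fat_class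
  have := h 11 a b c ha hb hc 0
  omega

end SmoothPointwise

end TotalsLaw

end Summit.ValiantsHypothesis.ValiantsHypothesis.Theorems.NewtonUnitEquationsDissociatedUniform
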